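import Summits.HodgeConjecture.HodgeConjecture.Theorems.K2E1bArchPacketSignsOfParts   -- ★ Q11 p856747 (commit 95ad46634ebe): `CDPseudoCoeffWith`, `UnitaryDualWith`, `archPacketSignsLetter_of_parts`
import Summits.HodgeConjecture.HodgeConjecture.Theorems.K2E1bCubicCasimirDefs         -- ★ D-U8-1 p856708 (commit dba043de1013): `HasCubicPin`, `SameCubicPin`
import Summits.HodgeConjecture.HodgeConjecture.Theorems.K2E1bDSClsOfRecord            -- ★ Q9c p856729 (K2E4-p10 (g2)): `dsClsOfRecord`, `dsCarriersOfRecord`, `lawChi_dsCarriersOfRecord`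
import Summits.HodgeConjecture.HodgeConjecture.Theorems.K2E1bDSRecordLawDistinct      -- ★ Q9d p856892 (K2E4-p10 (g2)): `lawDistinct_dsCarriersOfRecord` (z₀-spectrum class invariant) — pays U8-4d
import Summits.HodgeConjecture.HodgeConjecture.Theorems.K2E1bDSRecordLawGlob          -- ★ Q9e p856855 (K2E4-p10 (g2)): `lawGlob_dsCarriersOfRecord` (★ A-letter `hasUnitaryGlobalization_of_isInfUnitary_uTwoOne`) — pays U8-4e
import Summits.HodgeConjecture.HodgeConjecture.Theorems.K2E1bIrredUnitaryHasGKClass    -- ★ U8-11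
import Summits.HodgeConjecture.HodgeConjecture.Theorems.K2E1bArchOpTraceExists         -- ★ U8-10a
import Summits.HodgeConjecture.HodgeConjecture.Theorems.K2E1bUnitaryDualOfParts       -- ★ Q12 p857054 (commit ef5e0e1e8fe5; K2E1b-plan (g3) cand v3 e323732dd0700f1c = tree): the four named inputs of 8b + `unitaryDualWith_of_parts`
import Summits.HodgeConjecture.HodgeConjecture.Theorems.K2E1bDatumUnitaryDual         -- ★ 8b-β p857113 (commit 35ccb9c629b6; K2E4-p10 (g3)): `K2E1bDatumUnitaryDual.datumUnitaryDualStmt_holds : DatumUnitaryDualStmt` (head `datumUnitaryDual_at_regular`, over ★ part 1 p857081 `K2E1bDatumCubicScalar`)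
import Summits.HodgeConjecture.HodgeConjecture.Theorems.K2E1bRecordIrreducible         -- ★ 8b-α′ p857118 (commit b6f30eaeef99; K2-defs1 (g3)): `U8.recordIrreducible : RecordIrreducibleStmt`
import Summits.HodgeConjecture.HodgeConjecture.Theorems.K2E1bUnitaryDualOfPartsCohUnitary  -- ★ Q13 p857176 (tree sha16 5bd7eb6d405a2151; K2E1b-plan (g4) cand, filed K2-defs1 (g3)): `ModelOfRecordCohUnitaryStmt`, `unitaryDualWith_of_parts_cohUnitary`
import Summits.HodgeConjecture.HodgeConjecture.Theorems.K2E1bModelOfRecordCohUnitary   -- ★ 8b-αᵤ p857446 (K2-defs1 (g3) ∕ K2E4-p10 (g3), αᵤ road files 1–5): `modelOfRecordCohUnitary : ModelOfRecordCohUnitaryStmt`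
import Summits.HodgeConjecture.HodgeConjecture.Theorems.K2E1bUnitarityDescends        -- ★ 8b-δ p857177 (tree sha16 fb739928c18111da; K2E4-p10 (g3)): `K2E1bUnitarityDescends.unitarityDescends` — pays 8b-δ
import HarnessLib

/-!
# K2 ∕ E1b tier 1 · unit U8d «CLOZEL–DELORME PSEUDO-COEFFICIENTS WITH χ-SUPPORT» (LEVEL B′ of TABLE ED. 7 §2c; K2-lead R17 2026-09-04T01:56Z)

ED. 6 (K2E1b-plan (g4), 2026-09-04T04:55Z; ED. 5b = commit 64b39a778b54 sha16 3b052e59ec327aa5, BW74 BUILT 04:11:54Z): socket 8b-αᵤ PAID BY NAME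
`sig_K2E1bModelOfRecordCohUnitary := Summit.HodgeConjecture.HodgeConjecture.Cruxes.H413.K2E1bGKCohomologyU21.U8.modelOfRecordCohUnitary` (★ p857446, the head of the in-house αᵤ road:
★ p857218 `K2E1bU21WeightSpaces` + ★ p857265 `K2E1bU21HighestWeightSpaces` (O4) → ★ p857192 `K2E1bU21KTypeStrings` (O5) + ★ p857241 `K2E1bU21KTypeMultiplicityOne` (O3) →
★ p857269 `K2E1bU21PActionNormalForm` (O6) → ★ p857310 `K2E1bU21NormalFormFamily` + ★ p857334 `K2E1bU21DatumRelations :: exists_datum` (O7+O8, K2E4-p10 (g3)) → ★ p857317 `K2E1bGKStableOfLieStable`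
(𝔨-stable ⇒ K-stable, relative graph trick) + ★ p857364 `K2E1bU21KStringSpan` + ★ p857386 `K2E1bU21HwLineMultiplicityOne :: hwLines_of_isCohUnitaryIrrep` (K2-defs1 (g3)) →
★ p857370 `K2E1bU21ModelIntertwinerBasis` + ★ p857395 `K2E1bU21ModelIntertwiner :: exists_intertwiner_of_datum` + ★ p857416 `K2E1bU21ModelEquiv :: exists_lieEquiv_of_datum`
(O9, K2E4-p10 (g3)) → ★ p857399 `K2E1bModelOfRecordPrelims` + this head (K2-defs1 (g3)); `map_ρK` for free by ★ `GKModulesKActionUnique.areGKEquivalent_of_lieEquiv`); socket 8b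
`sig_K2E1bUnitaryDualAtRegularChi` is thereby 0-sorry BY NAME over {αᵤ ★, α′ ★, β ★, δ ★} (`--axioms` TRIO, no `sorryAx`); the LIVE OPEN CONE of U8-1 is {8a
`sig_K2E1bCDPseudoCoefficient`} alone; code sorries 2 = {8a, 8b-α OPEN-ASIDE}.  Statement bytes of every socket UNCHANGED.

ED. 5 (K2E1b-plan (g4), 2026-09-04; ED. 4 = commit 469be40edba0 sha16 b1a1a3b62857c172, BW70 BUILT 03:56:25Z; ED. 5b = prose fix W1 of K2E1b-r01 (g4)
03:58:39Z, no Lean change): the 8b-α RE-CUT «αᵤ» — K2-defs1 (g3) census `CENSUS-8b-alpha-ModelOfRecord` (sha16 e0dd039e6bb73e61) found that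
★ `ModelOfRecordStmt` (binder `IsAdmissibleGK` on the irreducible bundle `GKIrrep G21`) over-asks: `K`-multiplicity ≤ 1 is ★-reachable for irreducible
UNITARY modules only (Gelfand pair, ★ `exists_forall_homSpace_eq_smul_of_commute_orbitalOp`), while α as typed also covers the NON-UNITARY irreducible
admissible modules (Kraljević 1973 — true in print, not in the tree); and 8b consumes the model only ON THE COH-UNITARY CLASS (Q12 applies 8b-α at
`hcoh.adm`).  Hence: NEW OPEN socket 8b-αᵤ
`sig_K2E1bModelOfRecordCohUnitary : ModelOfRecordCohUnitaryStmt` (★ Q13 `Theorems/K2E1bUnitaryDualOfPartsCohUnitary.lean`, p857176; binder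
`IsCohUnitaryIrrep`, otherwise token-for-token ★ `ModelOfRecordStmt`; in-house road = census files 1–5, 0 new named inputs), socket 8b RE-PAID BY NAME
`:= unitaryDualWith_of_parts_cohUnitary levelBPin (fun _ _ _ _ _ h => h) sig_K2E1bModelOfRecordCohUnitary sig_K2E1bRecordIrreducible
sig_K2E1bDatumUnitaryDual sig_K2E1bUnitarityDescends` (★ Q13 glue; 8b statement bytes UNCHANGED), and 8b-α `sig_K2E1bModelOfRecord` becomes OPEN-ASIDE
(typed, frozen bytes, sorried, consumed by nothing on the live cone — precedent U8-7, K2-lead R17 Q2; it implies 8b-αᵤ by ★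
`modelOfRecordCohUnitary_of_modelOfRecord`) and 8b-δ `sig_K2E1bUnitarityDescends := K2E1bUnitarityDescends.unitarityDescends`
PAID BY NAME (★ p857177 `Theorems/K2E1bUnitarityDescends.lean`, K2E4-p10 (g3): the coh-unitary form is `𝔤`-invariant by ★ `isInfUnitary_of_isInfUnitaryAlongP`,
transported along the `GKEquiv`, the twist scalar is purely imaginary (★ `conj_twistScalar`), and Kovačević’s signs are read off `𝔲(2,1) ↪ 𝔤𝔩₃`).
Statement bytes of every pre-existing socket UNCHANGED; open sockets of this module
after ED. 5: 8a, 8b-α (ASIDE), 8b-αᵤ (3 code `sorry`); live open cone of U8-1 = {8a (XL), 8b-αᵤ (L–XL)}.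

ED. 4 (K2E1b-plan (g4), 2026-09-04; ED. 3 = commit 468ccc004c85 sha16 6c1144c3e781ec08, BW64 BUILT 03:32:40Z): two bricks of socket 8b PAID
BY NAME from landed theorems OF EXACTLY THE SOCKET TYPE — 8b-β `sig_K2E1bDatumUnitaryDual := K2E1bDatumUnitaryDual.datumUnitaryDualStmt_holds`
(★ p857113 `Theorems/K2E1bDatumUnitaryDual.lean`, K2E4-p10 (g3): vertex rigidity + power sums `p₁,p₂,p₃` ⇒ the local minimum is a vertex of
`D_φ, J_φ^±, D_φ^±, F_φ`; Wallach's unitarity cut ★ `prodAD∕BC_of_isUnitarizable` kills `J_φ^±, F_φ`; unique continuation against ★ `dsCellDatum`;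
over ★ part 1 p857081 `K2E1bDatumCubicScalar`) and 8b-α′ `sig_K2E1bRecordIrreducible := recordIrreducible` (★ p857118
`Theorems/K2E1bRecordIrreducible.lean`, K2-defs1 (g3): a `𝔤𝔩₃`-Lie submodule of `𝒟.V` is `K`-stable through ★ `SU21SubmoduleLattice`, so
`(𝔤,K)`-irreducibility of the record forces Lie-irreducibility).  K2E1b-r01 (g4) by-name TIE probes PASS (03:42:21Z β, 03:44:17Z α′; TRIO).
Statement bytes of every socket UNCHANGED; open sockets of this module after ED. 4: 8a, 8b-α, 8b-δ (3 code `sorry`); live open cone of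
U8-1 = {8a (XL), 8b-α (XL), 8b-δ (M)}.

ED. 3 (K2E1b-plan (g3), 2026-09-04; ED. 2 = commit 4adae8f5f530 sha16 5a9547e378be6457, BW58 BUILT 03:11:32Z): socket 8b
`sig_K2E1bUnitaryDualAtRegularChi` PAID BY NAME from ★ Q12 `unitaryDualWith_of_parts` (`Theorems/K2E1bUnitaryDualOfParts.lean`, p857054,
kernel-checked glue over ★ 8b-γ `K2E1bDSRecordRecognition.exists_mk_ofRecord_eq_cls`, p856936) applied to `P := levelBPin` and FOUR NEW OPEN
SOCKETS §2b, each typed by a ★ `def … : Prop` of Q12 (DEFS BEFORE SIGS, R17 (iv)): 8b-α `sig_K2E1bModelOfRecord : ModelOfRecordStmt` (XL —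
the Kraljević–Kovačević structure theorem, abstract module → datum), 8b-α′ `sig_K2E1bRecordIrreducible : RecordIrreducibleStmt` (M), 8b-β
`sig_K2E1bDatumUnitaryDual : DatumUnitaryDualStmt` (L; dealt K2E4-p10 (g3)), 8b-δ `sig_K2E1bUnitarityDescends : UnitarityDescendsStmt` (M).
Statement bytes of 8a ∕ 8b ∕ U8-4d ∕ U8-4e UNCHANGED; open sockets of this module after ED. 3: 8a, 8b-α, 8b-α′, 8b-β, 8b-δ (5 code `sorry`);
live open cone of U8-1 = {8a (XL), 8b-α (XL), 8b-α′ (M), 8b-β (L), 8b-δ (M)}.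

ED. 2 (K2E1b-plan (g3), 2026-09-04; ED. 1 = commit a68a83559f2d sha16 54bde554b774828c, BW53 BUILT): sockets U8-4d and U8-4e PAID BY NAME —
`sig_K2E1bDSRecordLawDistinct := K2E1bDSRecordLawDistinct.lawDistinct_dsCarriersOfRecord` (★ p856892, `Theorems/K2E1bDSRecordLawDistinct.lean`:
the `K`-central element `z₀ = i(E₁₁+E₂₂)` acts on the record module's `K`-type `(n,m)` by `i(m+2e)/3`, a `GKEquiv` transports `z₀`-eigenvectors,
and the three cells' `m`-ranges at a regular parameter are pairwise disjoint) and `sig_K2E1bDSRecordLawGlob :=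
K2E1bDSRecordLawGlob.lawGlob_dsCarriersOfRecord` (★ p856855, `Theorems/K2E1bDSRecordLawGlob.lean`: ★ `dsCellRep_package` → ★
`isInfUnitary_of_isInfUnitaryAlongP` → ★ `hasUnitaryGlobalization_of_isInfUnitary_uTwoOne`).  Statement bytes of all four sockets UNCHANGED;
open sockets of this module after ED. 2: 8a `sig_K2E1bCDPseudoCoefficient`, 8b `sig_K2E1bUnitaryDualAtRegularChi` (2 code `sorry`).

ED. 1 (K2E1b-plan (g3), 2026-09-04; = DRAFT v2 004f7354886604cb boxed by K2E1b-r01 (g3): PRE-BOX 02:14:15Z SHAPES∕QUOTES PASS + F1–F3 applied, RE-STAMP 02:17:34Z PASS;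
leaves ★ Q9c p856729, ★ D-U8-1 p856708, ★ Q11 p856747).  Record table: Q9c `Theorems/K2E1bDSClsOfRecord.lean`
(★ p856729, K2E4-p10 (g2), d9f8bb61f90605cf): `dsClsOfRecord a b c j` (total; at a regular parameter the class of `dsCellRep a b c j h`, ★ #23's
structure of record on ★ U8-3 `dsCellDatum j a b c`), `dsCarriersOfRecord : DSPacketCarriers := ⟨dsClsOfRecord⟩`, ★-in-Q9c `lawChi_dsCarriersOfRecord`.

THE CUT (print; pages = printed pages, e-text `paper:doi-10-24033-asens-1602` p0021 = p. 212, p0022 = p. 213): [ClozelDelorme1990, Prop. 4 p. 212]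
«Soit λ une forme linéaire discrète et admissible sur R(G), G de centre compact, et r > 0. Alors il existe f ∈ C_c^∞(G, K)_r telle que λ(π) = tr π(f)
pour toute représentation π de longueur finie.» and [ibid., Corollaire p. 213] «(Existence de pseudo-coefficients). Soit δ₀ ∈ Ĝ_d. Alors, pour tout
r > 0, il existe f ∈ C_c^∞(G, K)_r telle que (i) tr δ₀(f) = 1, (ii) tr π^P_{δ,ν}(f) = 0 pour toute représentation basique π^P_{δ,ν} de G différente
de δ₀.» (basic = `π^P_{δ,ν} = Ind_{P = MAN}^G(δ ⊗ e^ν ⊗ 1)`, `δ` a non-degenerate limit of discrete series of `M`, p. 194; `Ĝ_d` includes the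
non-degenerate limits); [ibid., p. 212 L22–26] «les π^P_{δ,ν} telles que n(δ,ν) ≠ 0 ont même caractère infinitésimal que π» and Lemme 6 p. 212
(«λ discrète; équivalents: (1) l'ensemble des représentations irréductibles π telles que λ(π) ≠ 0 est fini, (2) l'ensemble des π ∈ Ĝ telles que
λ(π) ≠ 0 est fini, (3) il existe un ensemble fini Y de K-types tel que λ(π) = 0 si π ne contient aucun K-type de Y; … on dit que λ est admissible»);
[White2012 = arXiv:1106.1127, Lemma 5.23]
«Let π be a discrete series representation of L(ℝ). Then there exists a pseudo-coefficient f_π ∈ C_c^∞(L(ℝ)) of π. The pseudo-coefficient f_π is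
K-finite and cuspidal. Furthermore, if Tr σ(f_π) ≠ 0 for some irreducible admissible representation σ of L(ℝ), then the infinitesimal characters of
σ and π are equal.»  (White's Lemma 5.24 «Tr σ(f_π) = δ_{σπ} for ALL irreducible admissible σ at regular highest weight» is used here ONLY for
irreducible UNITARY σ — for the non-unitary Langlands quotients `J_φ^±` of [Rogawski1990, §12.3] one has `tr J^±(f_{D^±}) = −1` in `R(G)` — and that
unitary case is exactly socket 8b below + [Rogawski1990, §12.3 p. 176] «J^± unitary iff n = 1 ∕ m = 1» [Wallach].)

CURRENCY.  «Same infinitesimal character as the cell `D^{(j)}_{φ(a,b,c)}`» is written with the three generators of `Z(𝔤𝔩₃)`: degree 1 and 2 by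
★ `IsChiPinnedCohUnitary x (casimirOf a b c) (centralOf a b c)` (which also records that the Harish-Chandra module of a unitary `ϖ` is coh-unitary),
degree 3 by ★ `SameCubicPin x (dsClsOfRecord a b c j)` (D-U8-1, RELATIVE pin — no closed form is asserted).  SUPPORT PREDICATE
`levelBPin a b c j x := IsChiPinnedCohUnitary x (casimirOf a b c) (centralOf a b c) ∧ SameCubicPin x (dsClsOfRecord a b c j)`.

SOCKETS (statement bytes frozen at hosting; payers BY NAME):
* 8a `sig_K2E1bCDPseudoCoefficient : CDPseudoCoeffWith dsCarriersOfRecord levelBPin` (XL, LETTER-grade analytic residual — Clozel–Delorme);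
* 8b `sig_K2E1bUnitaryDualAtRegularChi : UnitaryDualWith dsCarriersOfRecord levelBPin` (L–XL, algebraic — Kovačević's classification ★ + cubic
  scalars on the models + Wallach's non-unitarity ★ `SU21UnitarityNecessary`);
* U8-4d `sig_K2E1bDSRecordLawDistinct : dsCarriersOfRecord.LawDistinct`, U8-4e `sig_K2E1bDSRecordLawGlob : dsCarriersOfRecord.LawGlob` (M each,
  K2E4-p10 (g2)'s next bricks; `LawChi` is ★ `lawChi_dsCarriersOfRecord` of Q9c) — paid BY NAME in ED. 2 when ★.
COMPOSITION (R17 (iii), kernel-checked, leaf census = {8a, 8b, U8-4 laws, ★ U8-11, ★ U8-10a}):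
`archPacketSignsLetter_of_sigs : ArchPacketSignsLetter := archPacketSignsLetter_of_parts dsCarriersOfRecord levelBPin sig_U8-4d lawChi_dsCarriersOfRecord sig_U8-4e sig_8a sig_8b
  exists_isUnitaryGlobalization_of_isTopIrreducible archOpTraceExists` — then unit U8 ED. 3 pays U8-1 `sig_K2E1bArchPacketSigns := archPacketSignsLetter_of_sigs`.

HONEST LABEL: HC_CM is proved only modulo the 7 printed citations (2 remaining named inputs: hLiu418 = stmt-HodgeConjecture-24832,
h413 = stmt-HodgeConjecture-24833) until rung 0 closes; hosting this unit REPLACES one XL open socket (U8-1, which becomes a by-name composition)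
by two open sockets (8a XL letter-grade, 8b L–XL) + the U8-4 law rows; nothing closes at rung 0.
-/

set_option autoImplicit false
set_option linter.dupNamespace false

noncomputable section

open NumberField MeasureTheory CompactlySupported
open scoped Matrix MatrixGroups InnerProductSpace ENNReal

namespace Summit.HodgeConjecture.HodgeConjecture.Cruxes.H413.K2E1bGKCohomologyU21.U8

open Literature.NumberTheory.Automorphic
open Literature.RepresentationTheory.KonnoKonno2007 Literature.RepresentationTheory.KonnoKonno2007.RealDualPair
open Summit.HodgeConjecture.HodgeConjecture.Cruxes.H413.K2E1bGKCohomologyU21 (IsChiPinnedCohUnitary SameCubicPin)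
open Summit.HodgeConjecture.HodgeConjecture.Cruxes.H413.K2E1bDSClsOfRecord (dsClsOfRecord dsCarriersOfRecord lawChi_dsCarriersOfRecord)

/-! ## §1 The support predicate (a `def` with body — DEFS BEFORE SIGS: to be hoisted into a ★ leaf `Theorems/K2E1bLevelBPinDefs.lean` if a payer
must name it outside this module; inside the sockets it is unfolded by `CDPseudoCoeffWith`/`UnitaryDualWith` only through this name) -/

/-- **LEVEL-B′ support predicate**: `x` has the infinitesimal character of the cell `D^{(j)}_{φ(a,b,c)}` — degree ≤ 2 generators via the χ-pins
`(κ, e)(a,b,c)` (and `x` coh-unitary), degree 3 via the cubic pin of the record class. [cite: ClozelDelorme1990, Prop. 4] [cite: KnappVogan1995, Prop. 4.120] -/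
def levelBPin (a b c : ℤ) (j : Fin 3) (x : GKIrrClass (uFormGroup (Fin 2) (Fin 1))) : Prop :=
  IsChiPinnedCohUnitary x (casimirOf a b c) (centralOf a b c) ∧ SameCubicPin x (dsClsOfRecord a b c j)

/-! ## §2 The two LEVEL-B′ sockets -/

/-- **SOCKET 8a `sig_K2E1bCDPseudoCoefficient` (XL, LETTER-grade analytic residual) — the Clozel–Delorme pseudo-coefficient of the record cell
`D^{(j)}_{φ(a,b,c)}` with χ-support.**  For every Borel structure and Haar measure `ν` on `U(2,1)`, every regular `(a,b,c)` and `j : Fin 3` there is an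
archimedean test function `f` (smooth, compactly supported) with: `Θ_ϖ(f) = δ_{ij}` on every unitary globalization `ϖ` of the record class
`dsClsOfRecord a b c i` ([ClozelDelorme1990, Corollaire (i)–(ii)]: the three cells are discrete series, i.e. basic, and distinct), and `Θ_ϖ(f) = t ≠ 0`
on a unitary globalization of a class `x` only if `x` is coh-unitary with the χ-pins `(κ,e)(a,b,c)` and the cubic pin of `dsClsOfRecord a b c j`
([White2012, Lemma 5.23]: `Tr σ(f_π) ≠ 0 ⇒` same infinitesimal character; the centre `Z(𝔤𝔩₃) = ℂ[C₁, C₂, C₃]` acts on the Harish-Chandra module of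
`ϖ` by the same scalars as on the cell).  QUOTES: see the module docstring (token for token from the materialised pages p0021 L44–48, p0022 L3–7 of
`paper:doi-10-24033-asens-1602` = printed pp. 212–213, and p0016 of `paper:arxiv-1106.1127`).  TRUE ONLY JOINTLY WITH the record table's
`LawChi` (★ `lawChi_dsCarriersOfRecord`: the `(κ,e)` pins are absolute) and `LawDistinct` (K2E1b-r01 (g3) GUARD A′) — both are leaves of the
composition below.
[cite: ClozelDelorme1990, Prop. 4, Corollaire] [cite: Rogawski1990, §13.8 p. 218] [cite: KnappVogan1995, Prop. 4.120] -/
theorem sig_K2E1bCDPseudoCoefficient : CDPseudoCoeffWith dsCarriersOfRecord levelBPin := by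
  sorry

/-! ## §2b The bricks of socket 8b (ED. 3: α, α′, β, δ typed by the ★ `def … : Prop`s of Q12 `K2E1bUnitaryDualOfParts`; ED. 5: + αᵤ typed by ★ Q13) — after ED. 5: 8b-αᵤ OPEN; 8b-α OPEN-ASIDE; 8b-α′, 8b-β, 8b-δ PAID BY NAME -/

/-- **OPEN-ASIDE since ED. 5 (off the live cone: socket 8b is re-paid over the weaker 8b-αᵤ `sig_K2E1bModelOfRecordCohUnitary`; this stronger statement
implies it by ★ `modelOfRecordCohUnitary_of_modelOfRecord`; bytes frozen, not staffed — K2-defs1 (g3) census e0dd039e6bb73e61 + K2E1b-r01 (g4) W1: as typed it also covers the NON-UNITARY irreducible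
admissible modules, whose `K`-multiplicity one is Kraljević 1973 (true in print, not in the tree; the tree's Gelfand-pair theorem reaches the unitary
irreducibles only), so it is kept as a typed stronger statement nobody consumes).**
**SOCKET 8b-α `sig_K2E1bModelOfRecord` (XL; ED. 3) — «MODEL OF RECORD», the Kraljević–Kovačević structure theorem (abstract module →
datum; the direction absent from the tree, ★ `exists_equiv_model_of_isIrreducible` being datum → model among the cohomological six)**: every
admissible irreducible `(𝔤,K)`-module `r` of `U(2,1)` with χ-scalars `(κ,e)` is `(𝔤,K)`-equivalent to the structure of record (★ #23
`ρKOfRecord 𝒟 e`, `σOfRecord 𝒟 e`) of a Kovačević datum `𝒟` at the central weight `e` (statement = ★ `ModelOfRecordStmt`).  Road: the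
`K`-types of `r` have multiplicity one (Kovačević §3 «since dim 𝔞 = 1 … the multiplicity of K modules V_{nm} is 1»; Kraljević 1973 for
`SU(n,1)`); weight bases `u^k_{n,m}` adapted to `𝔭 ⊗ V_{n,m} = ⊕ V_{n±1,m±3}`; the relations (b20)–(b45) of ★ `SU21Datum` hold in any such
basis; integrality `6 ∣ m − 3n + 3 + 2e` from the genuine `K`-action (★ `isGKModule_ofRecord`).  Why it might fail: a normalisation of ★
`SU21Datum` (Def. 1 coefficients) not reachable by rescaling in some module — CENSUS FIRST.
[cite: Kovacevic2021, §3 Def. 1, Thm. 1–2] [cite: BorelWallach2000, 0 §2.5] -/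
theorem sig_K2E1bModelOfRecord : ModelOfRecordStmt := by
  sorry

/-- **★ PAID BY NAME (ED. 6, p857446 `K2E1bModelOfRecordCohUnitary`).**  **SOCKET 8b-αᵤ `sig_K2E1bModelOfRecordCohUnitary` (L–XL; ED. 5) — «MODEL OF RECORD ON THE COH-UNITARY CLASS»** (statement = ★ Q13
`ModelOfRecordCohUnitaryStmt`, `Theorems/K2E1bUnitaryDualOfPartsCohUnitary.lean`): every coh-unitary irreducible `(𝔤,K)`-module `r` of
`U(2,1)` (★ `IsCohUnitaryIrrep`: admissible, irreducible, unitary along `𝔭 ⊕ ℝz₀`) with χ-scalars `(κ,e)` is `(𝔤,K)`-equivalent to the record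
(★ #23 `ρKOfRecord 𝒟 e`, `σOfRecord 𝒟 e`) of a Kovačević datum `𝒟` at the central weight `e`.  This is exactly what socket 8b consumes (★ Q12
applied 8b-α only at `hcoh.adm`; K2-defs1 (g3) census e0dd039e6bb73e61, recommendation R1); 8b-α ⇒ 8b-αᵤ is ★
`modelOfRecordCohUnitary_of_modelOfRecord`.  Road (in-house, census files 1–5, 0 new named inputs): O4 joint torus weight spaces `wtSpace`,
`hwSpace = wtSpace w ⊓ ker E₀₁`, labels `n − 1 = w₀ − w₁`, `m = w₀ + w₁ − 2w₂`, `e = Σ w` (`Theorems/K2E1bU21WeightSpaces.lean`, K2-defs1 (g3))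
→ O5 the `𝔨`-sl₂-strings `u^{k+1} := (−Y_α)^k u¹` via Mathlib `IsSl2Triple` (`K2E1bU21KTypeStrings`, K2E4-p11 (g2)) + O3 `K`-multiplicity ≤ 1
transported from ★ `exists_forall_homSpace_eq_smul_of_commute_orbitalOp` (Gelfand's trick over `KAK`) through ★ `isInfUnitary_of_isInfUnitaryAlongP`
and ★ `hasUnitaryGlobalization_of_isInfUnitary_uTwoOne` (`K2E1bU21KTypeMultiplicityOne`) → O6 the normal form of the `𝔭^±`-action
`𝔭 ⊗ V_{n,m} ⊂ ⊕ V_{n±1,m±3}` (`K2E1bU21PActionNormalForm`) → O7+O8 the relations (b20)–(b45) ⇒ an ★ `SU21Datum` in Kovačević's gauge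
`Y_α u^k = −u^{k+1}`, `A = a∕n` (`K2E1bU21DatumRelations`) → O9 the `GKEquiv` to `(ρKOfRecord 𝒟 e, σOfRecord 𝒟 e)` with `hGK` from ★
`isGKModule_ofRecord` (`6 ∣ m − 3n + 3 + 2e` is automatic: `= 6α` on `det^α Sym^{n−1} ⊠ u^β`; head `modelOfRecordCohUnitary :
ModelOfRecordCohUnitaryStmt`).  Why it might fail: only O3 uses coh-unitarity (multiplicity one via the unitary globalization) — a module whose
forced 𝔭-coefficients match ★ `SU21Datum`'s fields only up to a sign convention would surface in O8 (pre-box against ★ `SU21ModulesFromKTypes`).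
[cite: Kovacevic2021, §3 Def. 1, Thm. 1–2] [cite: BorelWallach2000, 0 §2.5] -/
theorem sig_K2E1bModelOfRecordCohUnitary : ModelOfRecordCohUnitaryStmt :=
  Summit.HodgeConjecture.HodgeConjecture.Cruxes.H413.K2E1bGKCohomologyU21.U8.modelOfRecordCohUnitary

/-- **SOCKET 8b-α′ `sig_K2E1bRecordIrreducible` (M; ED. 3) — «AN IRREDUCIBLE RECORD HAS AN IRREDUCIBLE DATUM»**: if the record of `𝒟` at `e` is
an irreducible `(𝔤,K)`-module then `𝒟.V` is an irreducible `𝔤𝔩₃(ℂ)`-Lie module (statement = ★ `RecordIrreducibleStmt`).  Road: a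
`𝔤𝔩₃`-submodule is a sum of `(H_α,H_β)`-weight spaces and is stable under the `𝔨`-Casimir, hence a sum of whole `K`-types (★
`SU21KTypeMultiplicity`: `Ktype_eq_supported`, `isInternal_Ktype`), hence stable under ★ `kTypeRepTw`; ★ `IsIrreducibleGK.nontrivial`.
**PAID BY NAME (ED. 4)** from ★ p857118 `Theorems/K2E1bRecordIrreducible.lean :: U8.recordIrreducible : RecordIrreducibleStmt` (K2-defs1 (g3);
same namespace as this module; statement bytes of this socket UNCHANGED).
[cite: Kovacevic2021, §3 Thm. 1] [cite: KnappVogan1995, §II.4] -/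
theorem sig_K2E1bRecordIrreducible : RecordIrreducibleStmt :=
  recordIrreducible

/-- **SOCKET 8b-β `sig_K2E1bDatumUnitaryDual` (L; ED. 3) — «DATUM-LEVEL UNITARY DUAL AT A REGULAR INFINITESIMAL CHARACTER»** (statement = ★
`DatumUnitaryDualStmt`; dealt to K2E4-p10 (g3) as `Theorems/K2E1bDatumUnitaryDual.lean :: datumUnitaryDual_at_regular`): an irreducible
unitarizable datum whose record at `e = centralOf a b c` has χ-scalars `(casimirOf a b c, centralOf a b c)` and the cubic pin of the record cell
`j` has the `K`-types and the invariant products of some record cell `i` — the six irreducibles at `χ_φ` are `F_φ, J_φ^±, D_φ, D_φ^±`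
[Rogawski1990, §12.2–12.3]; `J_φ^±` are not unitarizable at a regular parameter (★ U8-5 p856781 `dsCellJplus_not_isUnitarizable`,
`dsCellJminus_not_isUnitarizable`), nor is `F_φ` (`dim > 1`); Kovačević's ★ principal-series cells enumerate the data; the cubic calibration is
U8-4c (iii).  Why it might fail: only through a convention slip in the pins — guarded by the RELATIVE cubic pin.
**PAID BY NAME (ED. 4)** from ★ p857113 `Theorems/K2E1bDatumUnitaryDual.lean :: K2E1bDatumUnitaryDual.datumUnitaryDualStmt_holds :
U8.DatumUnitaryDualStmt` (K2E4-p10 (g3); head `datumUnitaryDual_at_regular` = the def body token for token; statement bytes of this socket UNCHANGED).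
[cite: Rogawski1990, §12.3 pp. 176–178] [cite: Kovacevic2021, §3 Thm. 3; §4 Thm. 4] [cite: BorelWallach2000, VI Thm. 4.12] -/
theorem sig_K2E1bDatumUnitaryDual : DatumUnitaryDualStmt :=
  K2E1bDatumUnitaryDual.datumUnitaryDualStmt_holds

/-- **SOCKET 8b-δ `sig_K2E1bUnitarityDescends` (M; ED. 3) — «UNITARITY DESCENDS TO THE DATUM»** (statement = ★ `UnitarityDescendsStmt`): a
coh-unitary module (★ `IsCohUnitaryIrrep`: admissible, irreducible, unitary along `𝔭 ⊕ ℝz₀`) that is `(𝔤,K)`-equivalent to the record of `𝒟`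
at `e` makes `𝒟` unitarizable (★ `SU21Datum.IsUnitarizable`).  Road: ★ `isInfUnitary_of_isInfUnitaryAlongP` (a `𝔤`-invariant positive
Hermitian form), transport along the `GKEquiv` (★ `GKIrrClass.mk_eq_mk_iff`), strip the purely imaginary twist scalar (★ `conj_twistScalar`),
read Kovačević's signs off `𝔲(2,1) ↪ 𝔤𝔩₃` (converse of ★ `hasInvariantHermitianForm_kovLie_of_isUnitarizable`).  Why it might fail: it should
not (pure transport); size risk only.
**PAID BY NAME (ED. 5)** from ★ p857177 `Theorems/K2E1bUnitarityDescends.lean :: K2E1bUnitarityDescends.unitarityDescends :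
U8.UnitarityDescendsStmt` (K2E4-p10 (g3); `form_upqLieC_eq_neg_upqTheta`, `hasInvariantHermitianForm_of_isCohUnitaryIrrep`,
`hasInvariantHermitianForm_of_gkEquiv`, `isUnitarizable_of_hasInvariantHermitianForm_σOfRecord`, `isUnitarizable_of_mk_eq_mk`; statement bytes
of this socket UNCHANGED).
[cite: BorelWallach2000, VI Thm. 4.12] [cite: Kovacevic2021, §4 Thm. 4] -/
theorem sig_K2E1bUnitarityDescends : UnitarityDescendsStmt :=
  K2E1bUnitarityDescends.unitarityDescends

/-! ## §2c Socket 8b — PAID BY NAME (ED. 3 over α, α′, β, δ; RE-PAID ED. 5 over αᵤ, α′, β, δ — after ED. 5 its open leaf is 8b-αᵤ only) -/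

/-- **SOCKET 8b `sig_K2E1bUnitaryDualAtRegularChi` (L–XL, algebraic) — the unitary dual of `U(2,1)` at a regular integral infinitesimal character is
the discrete-series packet.**  A coh-unitary class `x` with the χ-pins `(κ,e)(a,b,c)` and the cubic pin of the record cell `j` IS one of the three
record cells: `Π(φ) = {F_φ, J_φ^±, D_φ, D_φ^±}` [Rogawski1990, §12.3 pp. 176–178] and at regular `φ` (`IsRegularParam`: `a − b ≥ 2`, `b − c ≥ 2`)
`F_φ`, `J_φ^±` are not unitary [Rogawski1990, p. 176 «J^+ (resp. J^−) is unitary iff n = 1 (resp. m = 1)», Wallach]; in E1b currency: Kovačević's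
classification of irreducible `(𝔤,K)`-modules of `SU(2,1)` (★ `exists_model_of_isIrreducible`) + the central scalars `(e, κ, C₃)` of each model +
★ `SU21UnitarityNecessary`.  Why it might fail: only through a convention slip in the pins — guarded by the RELATIVE cubic pin.
**PAID BY NAME (ED. 3)** from ★ Q12 `unitaryDualWith_of_parts` (p857054) at `P := levelBPin`, `hP := fun _ _ _ _ _ h => h`, over the four
bricks of §2b (statement bytes of this socket UNCHANGED).
**RE-PAID BY NAME (ED. 5)** from ★ Q13 `unitaryDualWith_of_parts_cohUnitary` (p857176; the same kernel-checked glue over the WEAKER model brick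
8b-αᵤ `sig_K2E1bModelOfRecordCohUnitary : ModelOfRecordCohUnitaryStmt`) with 8b-α′ ★, 8b-β ★, 8b-δ ★ — statement bytes of this socket UNCHANGED; 8b-α is no longer consumed.
[cite: Rogawski1990, §12.3 pp. 176–178] [cite: Kovacevic2021, Thm. 4] [cite: BorelWallach2000, VI Thm. 4.11] -/
theorem sig_K2E1bUnitaryDualAtRegularChi : UnitaryDualWith dsCarriersOfRecord levelBPin :=
  unitaryDualWith_of_parts_cohUnitary levelBPin (fun _ _ _ _ _ h => h)
    sig_K2E1bModelOfRecordCohUnitary sig_K2E1bRecordIrreducible sig_K2E1bDatumUnitaryDual sig_K2E1bUnitarityDescends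

/-! ## §3 The composition (R17 (iii)) — U8-1's letter from the sockets BY NAME -/

/-- **SOCKET U8-4d `sig_K2E1bDSRecordLawDistinct` — PAID BY NAME (ED. 2) from ★ p856892 `K2E1bDSRecordLawDistinct.lawDistinct_dsCarriersOfRecord` (K2E4-p10 (g2))**: the three record cells at a
regular parameter are pairwise non-isomorphic `(𝔤, K)`-module classes.  Recipe: ★ `GKIrrClass.mk_eq_mk_iff` + ★ `GKEquiv.commK` transport a
`K`-weight vector, and the record modules' `K`-type supports (★ `mem_dsCellDatum_S_iff`, vertices ★ U8-3) differ between cells.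
(print: Rogawski1990, §12.2 p. 175 «Π(φ) = {D, D⁺, D⁻}» three inequivalent discrete series) -/
theorem sig_K2E1bDSRecordLawDistinct : dsCarriersOfRecord.LawDistinct :=
  K2E1bDSRecordLawDistinct.lawDistinct_dsCarriersOfRecord

/-- **SOCKET U8-4e `sig_K2E1bDSRecordLawGlob` — PAID BY NAME (ED. 2) from ★ p856855 `K2E1bDSRecordLawGlob.lawGlob_dsCarriersOfRecord` (K2E4-p10 (g2))**: each record cell at a regular parameter
has a unitary globalization on `U(2,1)(ℝ)`.  Recipe: ★ `dsCellRep_package` (`IsCohUnitaryIrrep`: `isGKModule`, admissible, `unit : IsUnitaryAlongP` —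
same body as ★ `IsInfUnitaryAlongP`) → ★ `isInfUnitary_of_isInfUnitaryAlongP` → ★ `hasUnitaryGlobalization_of_isInfUnitary_uTwoOne` (the A-letter), then
★ `dsClsOfRecord_of_regular`.  (print: BorelWallach2000, 0 §2.5; Knapp1986, Thm. 9.20 ∕ Harish-Chandra globalization) -/
theorem sig_K2E1bDSRecordLawGlob : dsCarriersOfRecord.LawGlob :=
  K2E1bDSRecordLawGlob.lawGlob_dsCarriersOfRecord

/-- **`ArchPacketSignsLetter` from the LEVEL-B′ sockets.**  Leaf census (ED. 2): OPEN 8a, 8b (this module's sockets); ★ U8-4d p856892, ★ U8-4e p856855, ★-in-Q9c `lawChi_dsCarriersOfRecord`, ★ U8-11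
`exists_isUnitaryGlobalization_of_isTopIrreducible`, ★ U8-10a `archOpTraceExists`. [cite: ClozelDelorme1990, Prop. 4, Corollaire] [cite: Rogawski1990, §13.8 p. 218] -/
theorem archPacketSignsLetter_of_sigs : ArchPacketSignsLetter :=
  archPacketSignsLetter_of_parts dsCarriersOfRecord levelBPin
    sig_K2E1bDSRecordLawDistinct lawChi_dsCarriersOfRecord sig_K2E1bDSRecordLawGlob
    sig_K2E1bCDPseudoCoefficient sig_K2E1bUnitaryDualAtRegularChi
    exists_isUnitaryGlobalization_of_isTopIrreducible archOpTraceExists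

end Summit.HodgeConjecture.HodgeConjecture.Cruxes.H413.K2E1bGKCohomologyU21.U8

end
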